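import Summits.Ventures.PercRepro.S1NullityCells

/-!
# PercRepro — THE EXCLUSION WITH EXACTLY TWO POINTS OUTSIDE (p2, gen 23; SUBCLAIM-S1 §6.8)

The nullity lever's dependent count (S1Nullity `ncard_dep_fourSets_outside_le`) charges every triangle `T ⊄ S` with
`n − 3` four-sets. When `E ∖ S = O` has exactly two points and the exclusion asks for both of them (`k = 2`), a
dependent four-set `B ⊇ O` is a four-circuit, or `T ∪ {y}` for THE (at most one) triangle `T ⊇ O`, or `T ∪ O` for a
triangle `T` through exactly one point of `O` — so the charge is `s₄ + (n − 3) + #{T ⊄ S}` instead of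
`s₄ + #{T ⊄ S}·(n − 3)`: at `(10, 6)`, `t = 8`, the last open line of the cell (`m = 2`) gains `23` four-sets.

* `ncard_dep_fourSets_two_outside_le` — the refined dependent count;
* **`excl_ge_two`** — the refined exclusion `C(n − 2, 2) ≤ #{B independent four-set, O ⊆ B} + s₄ + (n − 3) + #{T ⊄ S}`.
Axioms: standard.
-/

open scoped Matroid

namespace PercRepro

namespace S1

open Set

variable {α : Type}

/-- **The dependent four-sets containing both points outside `S`** (`|E ∖ S| = 2`): four-circuits, the `n − 3`
supersets of the unique triangle through `E ∖ S`, and one four-set `T ∪ (E ∖ S)` per triangle `T ⊄ S`. -/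
theorem ncard_dep_fourSets_two_outside_le (M : Matroid α) [M.Finite]
    (hcirc : ∀ C, M.IsCircuit C → 3 ≤ C.encard) (hC1 : ∀ L ⊆ M.E, M.eRk L = 2 → L.ncard ≤ 3)
    {S : Set α} (hm : (M.E \ S).ncard = 2) :
    {B : Set α | B ⊆ M.E ∧ B.ncard = 4 ∧ M.Dep B ∧ 2 ≤ (B \ S).ncard}.ncard ≤
      {C : Set α | M.IsCircuit C ∧ C.ncard = 4}.ncard + (M.E.ncard - 3) +
      {C : Set α | M.IsCircuit C ∧ C.ncard = 3 ∧ ¬ C ⊆ S}.ncard := by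
  classical
  have hEfin : M.E.Finite := M.ground_finite
  set O := M.E \ S with hO
  have hOE : O ⊆ M.E := Set.sdiff_subset
  have hOfin : O.Finite := hEfin.subset hOE
  set 𝒯 := {C : Set α | M.IsCircuit C ∧ C.ncard = 3 ∧ ¬ C ⊆ S} with h𝒯
  have h𝒯fin : 𝒯.Finite := hEfin.finite_subsets.subset (fun C hC => hC.1.subset_ground)
  set Q := {C : Set α | M.IsCircuit C ∧ C.ncard = 4} with hQ
  have hQfin : Q.Finite := hEfin.finite_subsets.subset (fun C hC => hC.1.subset_ground)
  -- `K₁`: the supersets of the triangle through `O`, if any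
  set K₁ : Finset (Set α) := if h : ∃ C₀, M.IsCircuit C₀ ∧ C₀.ncard = 3 ∧ O ⊆ C₀ then
    oversets hEfin h.choose 1 else ∅ with hK₁
  have hK₁card : K₁.card ≤ M.E.ncard - 3 := by
    rw [hK₁]
    split_ifs with h
    · rw [card_oversets hEfin h.choose_spec.1.subset_ground, h.choose_spec.2.1, Nat.choose_one_right]
    · simp
  -- `K₂`: one four-set `C ∪ O` per triangle `C ⊄ S`
  set K₂ : Finset (Set α) := h𝒯fin.toFinset.image (fun C => C ∪ O) with hK₂
  have hK₂card : K₂.card ≤ 𝒯.ncard := by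
    calc K₂.card ≤ h𝒯fin.toFinset.card := Finset.card_image_le
      _ = 𝒯.ncard := (Set.ncard_eq_toFinset_card _ h𝒯fin).symm
  have hsub : {B : Set α | B ⊆ M.E ∧ B.ncard = 4 ∧ M.Dep B ∧ 2 ≤ (B \ S).ncard} ⊆
      Q ∪ ((K₁ ∪ K₂ : Finset (Set α)) : Set (Set α)) := by
    intro B hB
    obtain ⟨hBE, hB4, hdep, hout⟩ := hB
    have hBfin : B.Finite := hEfin.subset hBE
    -- `B ∖ S = O`
    have hBO : O ⊆ B := by
      have hsub' : B \ S ⊆ O := fun x hx => ⟨hBE hx.1, hx.2⟩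
      have heq : B \ S = O := Set.eq_of_subset_of_ncard_le hsub' (by omega) hOfin
      rw [← heq]; exact Set.sdiff_subset
    obtain ⟨C, hCB, hC⟩ := Matroid.Dep.exists_isCircuit_subset hdep
    have hCfin : C.Finite := hBfin.subset hCB
    have hC3 : 3 ≤ C.ncard := by
      have h := hcirc C hC
      rw [← hCfin.cast_ncard_eq] at h
      exact_mod_cast h
    have hC4 : C.ncard ≤ 4 := by rw [← hB4]; exact Set.ncard_le_ncard hCB hBfin
    rcases (show C.ncard = 3 ∨ C.ncard = 4 by omega) with h3 | h4
    · right
      rw [Finset.mem_coe, Finset.mem_union]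
      have hCS : ¬ C ⊆ S := by
        intro hCS
        have h1 : B \ S ⊆ B \ C := fun x hx => ⟨hx.1, fun hxC => hx.2 (hCS hxC)⟩
        have h2 : (B \ C).ncard = 1 := by rw [Set.ncard_sdiff hCB hCfin, hB4, h3]
        have := Set.ncard_le_ncard h1 (hBfin.subset Set.sdiff_subset)
        omega
      by_cases hOC : O ⊆ C
      · -- `C` is THE triangle through `O`
        left
        have hex : ∃ C₀, M.IsCircuit C₀ ∧ C₀.ncard = 3 ∧ O ⊆ C₀ := ⟨C, hC, h3, hOC⟩
        rw [hK₁, dif_pos hex]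
        have hC₀ := hex.choose_spec
        have hCC₀ : C = hex.choose := by
          by_contra hne
          have h1 := ncard_inter_le_one_of_triangles M hC1 ⟨hC, h3⟩ ⟨hC₀.1, hC₀.2.1⟩ hne
          have h2 : O ⊆ C ∩ hex.choose := Set.subset_inter hOC hC₀.2.2
          have := Set.ncard_le_ncard h2 (hCfin.subset Set.inter_subset_left)
          omega
        rw [mem_oversets hEfin hC₀.1.subset_ground]
        refine ⟨hCC₀ ▸ hCB, hBE, ?_⟩
        rw [← hCC₀, Set.ncard_sdiff hCB hCfin, hB4, h3]
      · -- `B = C ∪ O`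
        right
        rw [hK₂, Finset.mem_image]
        refine ⟨C, by rw [Set.Finite.mem_toFinset]; exact ⟨hC, h3, hCS⟩, ?_⟩
        have hCOB : C ∪ O ⊆ B := Set.union_subset hCB hBO
        have hinter : (C ∩ O).ncard ≤ 1 := by
          by_contra hlt
          push Not at hlt
          have heq : C ∩ O = O := Set.eq_of_subset_of_ncard_le Set.inter_subset_right (by omega) hOfin
          exact hOC (by rw [← heq]; exact Set.inter_subset_left)
        have hcard := Set.ncard_union_add_ncard_inter C O hCfin hOfin
        exact Set.eq_of_subset_of_ncard_le hCOB (by omega) hBfin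
    · left
      have hCB' : C = B := Set.eq_of_subset_of_ncard_le hCB (by rw [h4, hB4]) hBfin
      exact ⟨hCB' ▸ hC, hCB' ▸ h4⟩
  calc {B : Set α | B ⊆ M.E ∧ B.ncard = 4 ∧ M.Dep B ∧ 2 ≤ (B \ S).ncard}.ncard
      ≤ (Q ∪ ((K₁ ∪ K₂ : Finset (Set α)) : Set (Set α))).ncard :=
        Set.ncard_le_ncard hsub (hQfin.union (Finset.finite_toSet _))
    _ ≤ Q.ncard + ((K₁ ∪ K₂ : Finset (Set α)) : Set (Set α)).ncard := Set.ncard_union_le _ _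
    _ = Q.ncard + (K₁ ∪ K₂).card := by rw [Set.ncard_coe_finset]
    _ ≤ Q.ncard + (K₁.card + K₂.card) := by
        have := Finset.card_union_le K₁ K₂
        omega
    _ ≤ Q.ncard + (M.E.ncard - 3) + 𝒯.ncard := by omega

/-- **THE EXCLUSION WITH TWO POINTS OUTSIDE**: for `S ⊆ E` with `|E ∖ S| = 2`,
`C(n − 2, 2) ≤ #{B : |B| = 4, r(B) = 4, 2 ≤ |B ∖ S|} + s₄ + (n − 3) + #{T triangle, T ⊄ S}`. -/
theorem excl_ge_two (M : Matroid α) [M.Finite] (hcirc : ∀ C, M.IsCircuit C → 3 ≤ C.encard)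
    (hC1 : ∀ L ⊆ M.E, M.eRk L = 2 → L.ncard ≤ 3) {S : Set α} (hm : (M.E \ S).ncard = 2) :
    (M.E.ncard - 2).choose 2 ≤
      {B : Set α | B ⊆ M.E ∧ B.ncard = 4 ∧ M.eRk B = 4 ∧ 2 ≤ (B \ S).ncard}.ncard +
      ({C : Set α | M.IsCircuit C ∧ C.ncard = 4}.ncard + (M.E.ncard - 3) +
        {C : Set α | M.IsCircuit C ∧ C.ncard = 3 ∧ ¬ C ⊆ S}.ncard) := by
  classical
  have hEfin : M.E.Finite := M.ground_finite
  have hex := card_fourSets_exact_ge M (O := M.E \ S) Set.sdiff_subset (k := 2) (by norm_num)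
  rw [hm, Nat.choose_self, one_mul] at hex
  have hdep := ncard_dep_fourSets_two_outside_le M hcirc hC1 hm
  set A := {B : Set α | B ⊆ M.E ∧ B.ncard = 4 ∧ (B ∩ (M.E \ S)).ncard = 2} with hA
  set I := {B : Set α | B ⊆ M.E ∧ B.ncard = 4 ∧ M.eRk B = 4 ∧ 2 ≤ (B \ S).ncard} with hI
  set D := {B : Set α | B ⊆ M.E ∧ B.ncard = 4 ∧ M.Dep B ∧ 2 ≤ (B \ S).ncard} with hD
  have hIfin : I.Finite := hEfin.finite_subsets.subset (fun B hB => hB.1)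
  have hDfin : D.Finite := hEfin.finite_subsets.subset (fun B hB => hB.1)
  have hsub : A ⊆ I ∪ D := by
    intro B hB
    obtain ⟨hBE, hB4, hBk⟩ := hB
    have hBfin : B.Finite := hEfin.subset hBE
    have hBS : B \ S = B ∩ (M.E \ S) := by
      ext x; simp only [Set.mem_sdiff, Set.mem_inter_iff]; exact ⟨fun h => ⟨h.1, hBE h.1, h.2⟩, fun h => ⟨h.1, h.2.2⟩⟩
    by_cases hind : M.Indep B
    · left
      refine ⟨hBE, hB4, ?_, by rw [hBS, hBk]⟩
      rw [hind.eRk_eq_encard, ← hBfin.cast_ncard_eq, hB4]; rfl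
    · right
      refine ⟨hBE, hB4, ?_, by rw [hBS, hBk]⟩
      exact (M.dep_iff.2 ⟨hind, hBE⟩)
  calc (M.E.ncard - 2).choose 2 ≤ A.ncard := hex
    _ ≤ (I ∪ D).ncard := Set.ncard_le_ncard hsub (hIfin.union hDfin)
    _ ≤ I.ncard + D.ncard := Set.ncard_union_le _ _
    _ ≤ I.ncard + ({C : Set α | M.IsCircuit C ∧ C.ncard = 4}.ncard + (M.E.ncard - 3) +
        {C : Set α | M.IsCircuit C ∧ C.ncard = 3 ∧ ¬ C ⊆ S}.ncard) := by omega

end S1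

end PercRepro
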